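import Literature.Topology.FourManifolds.CerfStatementFour
import Literature.Topology.FourManifolds.DiscEmbeddingIsotopy
import HarnessLib

/-!
# Cerf, Ch. I §2: the named fact is equivalent to Théorème 1′ in monodromy form

Topic `Literature/Topology/FourManifolds`. J. Cerf, *Sur les difféomorphismes de la sphère de
dimension trois (Γ₄ = 0)*, LNM 53 (1968), Ch. I §2, after proving « (2) équivaut à (4)
`π₀(𝒢) = 0` » (`𝒢 = Diff D³`, the tree's `CerfStatementFour.lean`), continues: « Soit `ℰ`
l'espace des plongements de `D³` dans `R³` (…) `ℰ` est connexe (cf. Appendice, §5,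
proposition 3) (…) `ℛ = ℰ/𝒢ₑ` est un revêtement galoisien de `ℰ/𝒢`, de groupe `𝒢/𝒢ₑ ≈ π₀(𝒢)`
(…) (4) équivaut au THÉORÈME 1′. — Le revêtement `ℛ` admet une section. » The covering-space
statement lives in the `C^∞` topology of `ℰ`; its arc-wise content is the triviality of the
**monodromy** `π₁(ℰ/𝒢, D³) → π₀(𝒢)`: *a diffeomorphism of `D³` which terminates a smooth path
of embeddings `D³ → ℝ³` issued from the inclusion is diffeotopic to the identity*. This file
proves that this monodromy form is EQUIVALENT to the named fact
`Literature.Topology.FourManifolds.cerf_pi0DiffDisc_relBoundary_three`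
(`cerf_pi0DiffDisc_relBoundary_three_iff_monodromy`), through (4):

* (4′) ⟹ (4) (`discConnected_of_monodromy`, every `n + 1`): an orientation-preserving
  diffeomorphism `G` of `𝔻ⁿ⁺¹` has an ambient form `f` (Seeley) whose Jacobian determinant
  does not vanish on the ball (`det_fderiv_ne_zero_of_leftInvOn_closedBall`), hence has
  constant sign there (`det_fderiv_pos_of_pos_at_zero`); if positive, `f` terminates a path of
  embeddings issued from the identity by the connectedness of `ℰ_{n+1}`
  (`exists_isotopy_closedBall_of_det_pos`, `DiscEmbeddingIsotopy.lean` — Cerf's use of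
  Appendice §5, Prop. 3), so (4′) applies; if negative, the same argument applied to `R ∘ G`
  (`R` a hyperplane reflection of the disc, which reverses orientation,
  `closedBallCongr_reflection_isOrientationReversing`) would make `R ∘ G` both orientation
  preserving and reversing.
* (4) ⟹ (4′) (`monodromy_of_discConnected`, every `n + 1`): if `G` terminates a path of
  embeddings with positive Jacobian and reversed an orientation `o`, then `G ∘ R` would preserve
  `o`, hence be the end of a diffeotopy of the disc by (4); along a diffeotopy the ambient
  Jacobian at the centre keeps its sign (`det_pos_of_isUnit_path`), while that of `G ∘ R` is
  negative.

Everything here is proved; there are no definitions and no named facts.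

## References

* J. Cerf, *Sur les difféomorphismes de la sphère de dimension trois (Γ₄ = 0)*, Lecture Notes in
  Mathematics 53, Springer (1968), Ch. I §2 ((4) ⟺ Théorème 1′); Appendice §5, Proposition 3.
  [CerfDiffeoSphere1968]
* M. W. Hirsch, *Differential Topology*, GTM 33 (1976), Ch. 4 §4. [HirschDT1976]
-/

open scoped Manifold ContDiff Topology InnerProductSpace
open Set Function Metric

noncomputable section

namespace Literature.Topology.FourManifolds

/-- Local notation: `𝔼 n` is the model Euclidean space `EuclideanSpace ℝ (Fin n)`. -/
local notation "𝔼 " n:arg => EuclideanSpace ℝ (Fin n)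

/-- Local notation: `𝔻 n` is the closed unit ball in `EuclideanSpace ℝ (Fin n)`. -/
local notation "𝔻 " n:arg => (Metric.closedBall (0 : EuclideanSpace ℝ (Fin n)) 1)

attribute [local instance] fact_finrank_euclideanSpace_succ

variable {n : ℕ}

/-! ### Jacobians of ambient forms of diffeomorphisms of the disc -/

/-- If `finv ∘ f = id` on the closed unit ball and `f` maps the ball into itself, the Jacobian
determinant of `f` does not vanish on the closed ball (chain rule within the ball, which has
unique derivatives as a convex set with nonempty interior). [folklore] -/
theorem det_fderiv_ne_zero_of_leftInvOn_closedBall {f finv : 𝔼 (n + 1) → 𝔼 (n + 1)}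
    (hf : ContDiff ℝ ∞ f) (hfinv : ContDiff ℝ ∞ finv)
    (hmaps : MapsTo f (closedBall (0 : 𝔼 (n + 1)) 1) (closedBall 0 1))
    (hleft : ∀ x ∈ closedBall (0 : 𝔼 (n + 1)) 1, finv (f x) = x)
    {x : 𝔼 (n + 1)} (hx : x ∈ closedBall (0 : 𝔼 (n + 1)) 1) :
    LinearMap.det (fderiv ℝ f x : 𝔼 (n + 1) →ₗ[ℝ] 𝔼 (n + 1)) ≠ 0 := by
  have hud : UniqueDiffWithinAt ℝ (closedBall (0 : 𝔼 (n + 1)) 1) x :=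
    uniqueDiffOn_convex (convex_closedBall 0 1)
      (by rw [_root_.interior_closedBall _ one_ne_zero]; exact ⟨0, by simp⟩) x hx
  have h1 : HasFDerivWithinAt (finv ∘ f) ((fderiv ℝ finv (f x)).comp (fderiv ℝ f x))
      (closedBall 0 1) x :=
    ((hfinv.differentiable (by simp) (f x)).hasFDerivAt.hasFDerivWithinAt).comp x
      ((hf.differentiable (by simp) x).hasFDerivAt.hasFDerivWithinAt) hmaps
  have h2 : HasFDerivWithinAt (finv ∘ f) (ContinuousLinearMap.id ℝ (𝔼 (n + 1)))
      (closedBall 0 1) x :=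
    (hasFDerivWithinAt_id x _).congr (fun y hy => hleft y hy) (hleft x hx)
  have heq := hud.eq h1 h2
  intro h0
  have h3 := congrArg (fun A : 𝔼 (n + 1) →L[ℝ] 𝔼 (n + 1) =>
    LinearMap.det (A : 𝔼 (n + 1) →ₗ[ℝ] 𝔼 (n + 1))) heq
  simp only [det_clm_comp, ContinuousLinearMap.coe_id, LinearMap.det_id, h0, mul_zero] at h3
  exact zero_ne_one h3

/-- On the closed unit ball a nowhere-vanishing Jacobian determinant has the sign of its value at
the centre (follow the segment from the centre, `det_pos_of_isUnit_path`). [folklore] -/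
theorem det_fderiv_pos_of_pos_at_zero {f : 𝔼 (n + 1) → 𝔼 (n + 1)} (hf : ContDiff ℝ ∞ f)
    (hne : ∀ x ∈ closedBall (0 : 𝔼 (n + 1)) 1,
      LinearMap.det (fderiv ℝ f x : 𝔼 (n + 1) →ₗ[ℝ] 𝔼 (n + 1)) ≠ 0)
    (h0 : 0 < LinearMap.det (fderiv ℝ f 0 : 𝔼 (n + 1) →ₗ[ℝ] 𝔼 (n + 1)))
    {x : 𝔼 (n + 1)} (hx : x ∈ closedBall (0 : 𝔼 (n + 1)) 1) :
    0 < LinearMap.det (fderiv ℝ f x : 𝔼 (n + 1) →ₗ[ℝ] 𝔼 (n + 1)) := by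
  have hx1 : ‖x‖ ≤ 1 := mem_closedBall_zero_iff.mp hx
  have key := det_pos_of_isUnit_path (A := fun u : ℝ => fderiv ℝ f (u • x))
    ((hf.continuous_fderiv (by simp)).comp (continuous_id.smul continuous_const))
    (fun u hu => ?_) ?_
  · have : fderiv ℝ f ((1 : ℝ) • x) = fderiv ℝ f x := by rw [one_smul]
    rw [← this]; exact key
  · have hmem : u • x ∈ closedBall (0 : 𝔼 (n + 1)) 1 := by
      rw [mem_closedBall_zero_iff, norm_smul, Real.norm_of_nonneg hu.1]
      calc u * ‖x‖ ≤ 1 * 1 := mul_le_mul hu.2 hx1 (norm_nonneg _) zero_le_one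
        _ = 1 := one_mul 1
    rw [ContinuousLinearMap.isUnit_iff_isUnit_toLinearMap, LinearMap.isUnit_iff_isUnit_det]
    exact isUnit_iff_ne_zero.mpr (hne _ hmem)
  · have : fderiv ℝ f ((0 : ℝ) • x) = fderiv ℝ f 0 := by rw [zero_smul]
    show 0 < LinearMap.det (fderiv ℝ f ((0 : ℝ) • x) : 𝔼 (n + 1) →ₗ[ℝ] 𝔼 (n + 1))
    rw [this]; exact h0

/-- The determinant of a hyperplane reflection of `ℝⁿ⁺¹` is `-1`. [folklore] -/
theorem det_coe_reflection_orthogonal_singleton {u : 𝔼 (n + 1)} (hu : u ≠ 0) :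
    LinearMap.det ((((ℝ ∙ u)ᗮ.reflection : 𝔼 (n + 1) ≃ₗᵢ[ℝ] 𝔼 (n + 1)) :
      𝔼 (n + 1) →L[ℝ] 𝔼 (n + 1)) : 𝔼 (n + 1) →ₗ[ℝ] 𝔼 (n + 1)) = -1 := by
  have h2 := (ℝ ∙ u)ᗮ.det_reflection
  rw [Submodule.orthogonal_orthogonal, finrank_span_singleton hu, pow_one] at h2
  exact h2

/-- The Jacobian of `A ∘ f` for a linear isometry `A`. [folklore] -/
theorem fderiv_linearIsometryEquiv_comp (A : 𝔼 (n + 1) ≃ₗᵢ[ℝ] 𝔼 (n + 1))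
    {f : 𝔼 (n + 1) → 𝔼 (n + 1)} (hf : ContDiff ℝ ∞ f) (x : 𝔼 (n + 1)) :
    fderiv ℝ (fun y => A (f y)) x =
      ((A : 𝔼 (n + 1) →L[ℝ] 𝔼 (n + 1))).comp (fderiv ℝ f x) :=
  (((A : 𝔼 (n + 1) →L[ℝ] 𝔼 (n + 1))).hasFDerivAt.comp x
    (hf.differentiable (by simp) x).hasFDerivAt).fderiv

/-! ### (4′) ⟹ (4): monodromy triviality implies the connectedness of `Diff⁺(𝔻ⁿ⁺¹)` -/

/-- **If every diffeomorphism of `𝔻ⁿ⁺¹` terminating a smooth path of embeddings `𝔻ⁿ⁺¹ → ℝⁿ⁺¹`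
issued from the inclusion is diffeotopic to the identity, then every orientation-preserving
diffeomorphism of `𝔻ⁿ⁺¹` is diffeotopic to the identity** (Cerf, Ch. I §2: Théorème 1′ ⟹ (4),
through the connectedness of `ℰ`, Appendice §5, Prop. 3). Paths of embeddings are jointly
`C^∞` families `F_t` of maps of `ℝⁿ⁺¹`, each injective with positive Jacobian determinant on the
closed unit ball, with `F_0 = id`. [cite: CerfDiffeoSphere1968, Ch. I §2, (4) ⟺ Théorème 1′] -/
theorem discConnected_of_monodromy
    (hm : ∀ F : ℝ → 𝔼 (n + 1) → 𝔼 (n + 1), ContDiff ℝ ∞ (uncurry F) → (∀ x, F 0 x = x) →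
      (∀ t, InjOn (F t) (closedBall 0 1)) →
      (∀ t, ∀ x ∈ closedBall (0 : 𝔼 (n + 1)) 1,
        0 < LinearMap.det (fderiv ℝ (F t) x : 𝔼 (n + 1) →ₗ[ℝ] 𝔼 (n + 1))) →
      ∀ G : (𝔻 (n + 1)) ≃ₘ⟮𝓡∂ (n + 1), 𝓡∂ (n + 1)⟯ (𝔻 (n + 1)),
        (∀ x : 𝔻 (n + 1), ((G x : 𝔻 (n + 1)) : 𝔼 (n + 1)) = F 1 x) →
        Diffeomorph.IsDiffeotopicToId G)
    (o : SmoothOrientation (𝓡∂ (n + 1)) (𝔻 (n + 1)))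
    (G : (𝔻 (n + 1)) ≃ₘ⟮𝓡∂ (n + 1), 𝓡∂ (n + 1)⟯ (𝔻 (n + 1)))
    (hG : G.IsOrientationPreserving o o) : Diffeomorph.IsDiffeotopicToId G := by
  -- ambient forms of `G` and `G⁻¹`
  obtain ⟨f, hf, hfG⟩ := exists_contDiff_extension_of_contMDiff_closedBall
    (fun x : 𝔻 (n + 1) => ((G x : 𝔻 (n + 1)) : 𝔼 (n + 1)))
    (contMDiff_coe_closedBall.comp G.contMDiff)
  obtain ⟨finv, hfinv, hfinvG⟩ := exists_contDiff_extension_of_contMDiff_closedBall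
    (fun y : 𝔻 (n + 1) => ((G.symm y : 𝔻 (n + 1)) : 𝔼 (n + 1)))
    (contMDiff_coe_closedBall.comp G.symm.contMDiff)
  have hfG' : ∀ (x : 𝔼 (n + 1)) (hx : x ∈ closedBall (0 : 𝔼 (n + 1)) 1),
      f x = ((G ⟨x, hx⟩ : 𝔻 (n + 1)) : 𝔼 (n + 1)) := fun x hx => hfG ⟨x, hx⟩
  have hmaps : MapsTo f (closedBall (0 : 𝔼 (n + 1)) 1) (closedBall 0 1) := fun x hx => by
    rw [hfG' x hx]; exact (G _).2
  have hleft : ∀ x ∈ closedBall (0 : 𝔼 (n + 1)) 1, finv (f x) = x := fun x hx => by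
    rw [hfG' x hx, hfinvG (G ⟨x, hx⟩), G.symm_apply_apply]
  have hinj : InjOn f (closedBall 0 1) := fun x hx y hy hxy => by
    have := congrArg finv hxy
    rwa [hleft x hx, hleft y hy] at this
  have hne : ∀ x ∈ closedBall (0 : 𝔼 (n + 1)) 1,
      LinearMap.det (fderiv ℝ f x : 𝔼 (n + 1) →ₗ[ℝ] 𝔼 (n + 1)) ≠ 0 := fun x hx =>
    det_fderiv_ne_zero_of_leftInvOn_closedBall hf hfinv hmaps hleft hx
  rcases lt_or_gt_of_ne (hne 0 (by simp)) with hneg | hpos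
  · -- negative Jacobian: `R ∘ G` would be diffeotopic to the identity, a contradiction
    exfalso
    haveI : Nonempty (𝔻 (n + 1)) := ⟨⟨0, by simp⟩⟩
    set e₀ : 𝔼 (n + 1) := EuclideanSpace.single 0 1 with he₀
    have he₀0 : e₀ ≠ 0 := by
      intro h
      have := congrArg (fun w : 𝔼 (n + 1) => w 0) h
      simp [he₀] at this
    set A : 𝔼 (n + 1) ≃ₗᵢ[ℝ] 𝔼 (n + 1) := (ℝ ∙ e₀)ᗮ.reflection with hA
    set R : (𝔻 (n + 1)) ≃ₘ⟮𝓡∂ (n + 1), 𝓡∂ (n + 1)⟯ (𝔻 (n + 1)) := closedBallCongr A with hR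
    -- the ambient form `A ∘ f` of `R ∘ G` has positive Jacobian on the ball
    have hf' : ContDiff ℝ ∞ fun y => A (f y) := A.contDiff.comp hf
    have hformula : ∀ x, LinearMap.det (fderiv ℝ (fun y => A (f y)) x :
        𝔼 (n + 1) →ₗ[ℝ] 𝔼 (n + 1)) =
        -LinearMap.det (fderiv ℝ f x : 𝔼 (n + 1) →ₗ[ℝ] 𝔼 (n + 1)) := fun x => by
      rw [fderiv_linearIsometryEquiv_comp A hf, det_clm_comp,
        det_coe_reflection_orthogonal_singleton he₀0, neg_one_mul]
    have hdet' : ∀ x ∈ closedBall (0 : 𝔼 (n + 1)) 1,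
        0 < LinearMap.det (fderiv ℝ (fun y => A (f y)) x : 𝔼 (n + 1) →ₗ[ℝ] 𝔼 (n + 1)) := by
      refine fun x hx => det_fderiv_pos_of_pos_at_zero hf' (fun y hy => ?_) ?_ hx
      · rw [hformula]; exact neg_ne_zero.mpr (hne y hy)
      · rw [hformula]; exact neg_pos.mpr hneg
    have hinj' : InjOn (fun y => A (f y)) (closedBall 0 1) := fun x hx y hy hxy =>
      hinj hx hy (A.injective hxy)
    obtain ⟨F, hF, hF0, hF1, hFinj, hFdet⟩ :=
      exists_isotopy_closedBall_of_det_pos hf' hinj' hdet'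
    have hGR : Diffeomorph.IsDiffeotopicToId (G.trans R) :=
      hm F hF hF0 hFinj hFdet (G.trans R) fun x => by
        rw [hF1, Diffeomorph.coe_trans, comp_apply, hR, coe_closedBallCongr, hfG x]
    -- `R ∘ G` preserves `o`; but `G` preserves `o` and `R` reverses it
    have hpres : (G.trans R).IsOrientationPreserving o o := hGR.isOrientationPreserving o
    have hrevR : R.IsOrientationReversing o o :=
      closedBallCongr_reflection_isOrientationReversing he₀0 o
    have hcomp : IsOrientationPreserving o (-o)
        ((R : (𝔻 (n + 1)) → 𝔻 (n + 1)) ∘ (G : (𝔻 (n + 1)) → 𝔻 (n + 1))) :=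
      IsOrientationPreserving.comp_holds hrevR hG (R.mdifferentiable (by simp))
        (G.mdifferentiable (by simp)) (fun y => R.det_mfderiv_ne_zero (by simp) y)
        (fun y => G.det_mfderiv_ne_zero (by simp) y)
    have heq : ((R : (𝔻 (n + 1)) → 𝔻 (n + 1)) ∘ (G : (𝔻 (n + 1)) → 𝔻 (n + 1))) = (G.trans R) :=
      (Diffeomorph.coe_trans G R).symm
    rw [heq] at hcomp
    exact hpres.not_isOrientationReversing hcomp
  · -- positive Jacobian: `f` terminates a path of embeddings issued from the identity
    obtain ⟨F, hF, hF0, hF1, hFinj, hFdet⟩ :=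
      exists_isotopy_closedBall_of_det_pos hf hinj
        (fun x hx => det_fderiv_pos_of_pos_at_zero hf hne hpos hx)
    exact hm F hF hF0 hFinj hFdet G fun x => by rw [hF1, hfG x]

/-! ### (4) ⟹ (4′): along a diffeotopy the Jacobian at the centre keeps its sign -/

/-- **If every orientation-preserving diffeomorphism of `𝔻ⁿ⁺¹` is diffeotopic to the identity,
then so is every diffeomorphism terminating a smooth path of embeddings `𝔻ⁿ⁺¹ → ℝⁿ⁺¹` with
positive Jacobian** (Cerf, Ch. I §2: (4) ⟹ Théorème 1′). If such a `G` reversed an orientation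
`o` of the disc, `G ∘ R` (`R` a hyperplane reflection of the disc) would preserve `o`, hence end
a diffeotopy `D` of the disc; the Jacobian at the centre of the ambient form of `D_t` (Seeley,
`Diffeotopy.exists_ambient`) is invertible for all `t` and the identity at `t = 0`, so positive
at `t = 1` (`det_pos_of_isUnit_path`) — while it is `DF₁(0) ∘ A`, of negative determinant.
[cite: CerfDiffeoSphere1968, Ch. I §2, (4) ⟺ Théorème 1′] -/
theorem monodromy_of_discConnected
    (h4 : ∀ (o : SmoothOrientation (𝓡∂ (n + 1)) (𝔻 (n + 1)))
      (G : (𝔻 (n + 1)) ≃ₘ⟮𝓡∂ (n + 1), 𝓡∂ (n + 1)⟯ (𝔻 (n + 1))),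
      G.IsOrientationPreserving o o → Diffeomorph.IsDiffeotopicToId G)
    (F : ℝ → 𝔼 (n + 1) → 𝔼 (n + 1)) (hF : ContDiff ℝ ∞ (uncurry F)) (_hF0 : ∀ x, F 0 x = x)
    (_hFinj : ∀ t, InjOn (F t) (closedBall 0 1))
    (hFdet : ∀ t, ∀ x ∈ closedBall (0 : 𝔼 (n + 1)) 1,
      0 < LinearMap.det (fderiv ℝ (F t) x : 𝔼 (n + 1) →ₗ[ℝ] 𝔼 (n + 1)))
    (G : (𝔻 (n + 1)) ≃ₘ⟮𝓡∂ (n + 1), 𝓡∂ (n + 1)⟯ (𝔻 (n + 1)))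
    (hG : ∀ x : 𝔻 (n + 1), ((G x : 𝔻 (n + 1)) : 𝔼 (n + 1)) = F 1 x) :
    Diffeomorph.IsDiffeotopicToId G := by
  haveI : ConnectedSpace (𝔻 (n + 1)) :=
    isConnected_iff_connectedSpace.1
      ((convex_closedBall (0 : 𝔼 (n + 1)) 1).isPathConnected ⟨0, by simp⟩).isConnected
  haveI : Nonempty (𝔻 (n + 1)) := ⟨⟨0, by simp⟩⟩
  haveI : ContractibleSpace (𝔻 (n + 1)) := contractibleSpace_closedBall zero_le_one
  obtain ⟨o⟩ : IsOrientable (𝓡∂ (n + 1)) (𝔻 (n + 1)) := isOrientable_of_simplyConnectedSpace_holds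
  rcases Diffeomorph.isOrientationPreserving_or_isOrientationReversing_holds G (by simp) o o
    with hpres | hrev
  · exact h4 o G hpres
  · exfalso
    set e₀ : 𝔼 (n + 1) := EuclideanSpace.single 0 1 with he₀
    have he₀0 : e₀ ≠ 0 := by
      intro h
      have := congrArg (fun w : 𝔼 (n + 1) => w 0) h
      simp [he₀] at this
    set A : 𝔼 (n + 1) ≃ₗᵢ[ℝ] 𝔼 (n + 1) := (ℝ ∙ e₀)ᗮ.reflection with hA
    set R : (𝔻 (n + 1)) ≃ₘ⟮𝓡∂ (n + 1), 𝓡∂ (n + 1)⟯ (𝔻 (n + 1)) := closedBallCongr A with hR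
    have hrevR : R.IsOrientationReversing o o :=
      closedBallCongr_reflection_isOrientationReversing he₀0 o
    -- `G ∘ R` preserves `o`, hence ends a diffeotopy `D` of the disc
    have hR' : IsOrientationPreserving o (-o) (R : (𝔻 (n + 1)) → 𝔻 (n + 1)) := hrevR
    have hG' : IsOrientationPreserving (-o) (-(-o)) (G : (𝔻 (n + 1)) → 𝔻 (n + 1)) :=
      (isOrientationPreserving_neg_neg_iff o (-o) _).2 hrev
    rw [neg_neg] at hG'
    have hcomp : IsOrientationPreserving o o
        ((G : (𝔻 (n + 1)) → 𝔻 (n + 1)) ∘ (R : (𝔻 (n + 1)) → 𝔻 (n + 1))) :=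
      IsOrientationPreserving.comp_holds hG' hR' (G.mdifferentiable (by simp))
        (R.mdifferentiable (by simp)) (fun y => G.det_mfderiv_ne_zero (by simp) y)
        (fun y => R.det_mfderiv_ne_zero (by simp) y)
    have heq : ((G : (𝔻 (n + 1)) → 𝔻 (n + 1)) ∘ (R : (𝔻 (n + 1)) → 𝔻 (n + 1))) = (R.trans G) :=
      (Diffeomorph.coe_trans R G).symm
    rw [heq] at hcomp
    obtain ⟨D, hD⟩ := h4 o (R.trans G) hcomp
    -- ambient forms of the stages and inverse stages
    obtain ⟨d, e, hd, he, hdD, heD⟩ := Diffeotopy.exists_ambient D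
    have hed : ∀ (t : ℝ) (y : 𝔼 (n + 1)) (hy : y ∈ closedBall (0 : 𝔼 (n + 1)) 1),
        e (t, d (t, y)) = y := by
      intro t y hy
      have h1 : d (t, y) = ((D.toFun t ⟨y, hy⟩ : 𝔻 (n + 1)) : 𝔼 (n + 1)) := hdD t ⟨y, hy⟩
      have h2 : (⟨d (t, y), by rw [h1]; exact (D.toFun t ⟨y, hy⟩).2⟩ : 𝔻 (n + 1)) =
          D.toFun t ⟨y, hy⟩ := Subtype.ext h1
      rw [heD t ⟨d (t, y), by rw [h1]; exact (D.toFun t ⟨y, hy⟩).2⟩, h2, D.invFun_toFun]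
    -- the Jacobian of `d_t` at the centre
    obtain ⟨J, hJ⟩ : ∃ J : ℝ → (𝔼 (n + 1) →L[ℝ] 𝔼 (n + 1)),
        J = fun t => fderiv ℝ (fun y => d (t, y)) 0 := ⟨_, rfl⟩
    have hslice : ∀ t, ContDiff ℝ ∞ fun y => d (t, y) := fun t =>
      hd.comp (contDiff_const.prodMk contDiff_id)
    have heslice : ∀ t, ContDiff ℝ ∞ fun y => e (t, y) := fun t =>
      he.comp (contDiff_const.prodMk contDiff_id)
    have hJcont : Continuous J := by
      rw [hJ]
      have h1 : ContDiff ℝ ∞ fun t : ℝ => fderiv ℝ (fun y => d (t, y)) ((fun _ : ℝ => (0 : 𝔼 (n + 1))) t) :=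
        ContDiff.fderiv (f := fun t y => d (t, y)) (g := fun _ : ℝ => (0 : 𝔼 (n + 1)))
          (hd.comp (contDiff_fst.prodMk contDiff_snd)) contDiff_const (by simp)
      exact h1.continuous
    have hJunit : ∀ u ∈ Icc (0 : ℝ) 1, IsUnit (J u) := by
      intro u _
      -- `e_u ∘ d_u = id` near the centre
      have hev : (fun y => e (u, d (u, y))) =ᶠ[𝓝 (0 : 𝔼 (n + 1))] id := by
        filter_upwards [Metric.isOpen_ball.mem_nhds (Metric.mem_ball_self one_pos)] with y hy
        exact hed u y (Metric.ball_subset_closedBall hy)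
      have h1 : HasFDerivAt (fun y => e (u, d (u, y)))
          ((fderiv ℝ (fun y => e (u, y)) (d (u, 0))).comp (J u)) 0 := by
        rw [hJ]
        exact ((heslice u).differentiable (by simp) _).hasFDerivAt.comp 0
          ((hslice u).differentiable (by simp) 0).hasFDerivAt
      have h2 : HasFDerivAt (fun y => e (u, d (u, y))) (ContinuousLinearMap.id ℝ (𝔼 (n + 1))) 0 :=
        (hasFDerivAt_id (0 : 𝔼 (n + 1))).congr_of_eventuallyEq hev
      have heq2 := h1.unique h2
      have h3 := congrArg (fun B : 𝔼 (n + 1) →L[ℝ] 𝔼 (n + 1) =>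
        LinearMap.det (B : 𝔼 (n + 1) →ₗ[ℝ] 𝔼 (n + 1))) heq2
      simp only [det_clm_comp, ContinuousLinearMap.coe_id, LinearMap.det_id] at h3
      rw [ContinuousLinearMap.isUnit_iff_isUnit_toLinearMap, LinearMap.isUnit_iff_isUnit_det]
      exact isUnit_iff_ne_zero.mpr (right_ne_zero_of_mul_eq_one h3)
    have hJ0 : 0 < LinearMap.det (J 0 : 𝔼 (n + 1) →ₗ[ℝ] 𝔼 (n + 1)) := by
      have hev : (fun y => d (0, y)) =ᶠ[𝓝 (0 : 𝔼 (n + 1))] id := by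
        filter_upwards [Metric.isOpen_ball.mem_nhds (Metric.mem_ball_self one_pos)] with y hy
        rw [hdD 0 ⟨y, Metric.ball_subset_closedBall hy⟩, D.toFun_zero]; rfl
      rw [hJ]
      show 0 < LinearMap.det (fderiv ℝ (fun y => d (0, y)) 0 : 𝔼 (n + 1) →ₗ[ℝ] 𝔼 (n + 1))
      rw [hev.fderiv_eq, fderiv_id, ContinuousLinearMap.coe_id, LinearMap.det_id]
      exact one_pos
    have hJ1 := det_pos_of_isUnit_path hJcont hJunit hJ0
    -- but `d_1 = F_1 ∘ A` near the centre, of negative Jacobian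
    have hF1 : ContDiff ℝ ∞ (F 1) := hF.comp (contDiff_const.prodMk contDiff_id)
    have hev1 : (fun y => d (1, y)) =ᶠ[𝓝 (0 : 𝔼 (n + 1))] fun y => F 1 (A y) := by
      filter_upwards [Metric.isOpen_ball.mem_nhds (Metric.mem_ball_self one_pos)] with y hy
      have hy' : y ∈ closedBall (0 : 𝔼 (n + 1)) 1 := Metric.ball_subset_closedBall hy
      rw [hdD 1 ⟨y, hy'⟩, ← Diffeotopy.coe_stage, hD, Diffeomorph.coe_trans, comp_apply, hG, hR,
        coe_closedBallCongr]
    have hdet1 : LinearMap.det (J 1 : 𝔼 (n + 1) →ₗ[ℝ] 𝔼 (n + 1)) =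
        -LinearMap.det (fderiv ℝ (F 1) 0 : 𝔼 (n + 1) →ₗ[ℝ] 𝔼 (n + 1)) := by
      rw [hJ]
      show LinearMap.det (fderiv ℝ (fun y => d (1, y)) 0 : 𝔼 (n + 1) →ₗ[ℝ] 𝔼 (n + 1)) = _
      have hcompd : HasFDerivAt (fun y => F 1 (A y))
          ((fderiv ℝ (F 1) 0).comp ((A : 𝔼 (n + 1) →L[ℝ] 𝔼 (n + 1)))) 0 := by
        have h1 : HasFDerivAt (F 1) (fderiv ℝ (F 1) (A 0)) (A 0) :=
          (hF1.differentiable (by simp) _).hasFDerivAt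
        have hA : HasFDerivAt (fun y : 𝔼 (n + 1) => A y) ((A : 𝔼 (n + 1) →L[ℝ] 𝔼 (n + 1))) 0 :=
          ((A : 𝔼 (n + 1) →L[ℝ] 𝔼 (n + 1))).hasFDerivAt
        have h2 := HasFDerivAt.comp (0 : 𝔼 (n + 1)) (g := F 1) (f := fun y : 𝔼 (n + 1) => A y) h1 hA
        rw [map_zero] at h2
        exact h2
      rw [hev1.fderiv_eq, hcompd.fderiv, det_clm_comp,
        det_coe_reflection_orthogonal_singleton he₀0, mul_neg_one]
    have hpos : 0 < LinearMap.det (fderiv ℝ (F 1) 0 : 𝔼 (n + 1) →ₗ[ℝ] 𝔼 (n + 1)) :=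
      hFdet 1 0 (by simp)
    rw [hdet1] at hJ1
    linarith

/-! ### `n + 1 = 3`: the named fact in monodromy form -/

/-- **Cerf, Ch. I §2, « (4) équivaut au Théorème 1′ », threaded to the tree: the named fact
`cerf_pi0DiffDisc_relBoundary_three` is EQUIVALENT to the triviality of the monodromy of the
covering `ℛ → ℰ/𝒢`** — every diffeomorphism of `D³` terminating a smooth path of embeddings
`D³ → ℝ³` issued from the inclusion (jointly `C^∞` families of maps of `ℝ³` injective with
positive Jacobian on the closed unit ball, starting at the identity) is diffeotopic to the
identity. With `ℰ` connected (Appendice §5, Prop. 3, here `exists_isotopy_closedBall_of_det_pos`)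
this is the arc-wise content of Théorème 1′, « le revêtement `ℛ` admet une section » — the
statement proved by Chapters II–VI of the monograph. Forward: `monodromy_of_discConnected` with
`discConnected_of_cerf_pi0DiffDisc_relBoundary_three`; backward: `discConnected_of_monodromy`
with `cerf_pi0DiffDisc_relBoundary_three_iff_discConnected`.
[cite: CerfDiffeoSphere1968, Ch. I §2, (4) ⟺ Théorème 1′] -/
theorem cerf_pi0DiffDisc_relBoundary_three_iff_monodromy :
    cerf_pi0DiffDisc_relBoundary_three ↔
      ∀ F : ℝ → 𝔼 3 → 𝔼 3, ContDiff ℝ ∞ (uncurry F) → (∀ x, F 0 x = x) →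
        (∀ t, InjOn (F t) (closedBall 0 1)) →
        (∀ t, ∀ x ∈ closedBall (0 : 𝔼 3) 1,
          0 < LinearMap.det (fderiv ℝ (F t) x : 𝔼 3 →ₗ[ℝ] 𝔼 3)) →
        ∀ G : (𝔻 3) ≃ₘ⟮𝓡∂ 3, 𝓡∂ 3⟯ (𝔻 3), (∀ x : 𝔻 3, ((G x : 𝔻 3) : 𝔼 3) = F 1 x) →
          Diffeomorph.IsDiffeotopicToId G :=
  ⟨fun h F hF hF0 hFinj hFdet G hG => monodromy_of_discConnected
      (discConnected_of_cerf_pi0DiffDisc_relBoundary_three h) F hF hF0 hFinj hFdet G hG,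
    fun hm => cerf_pi0DiffDisc_relBoundary_three_iff_discConnected.2
      (fun o G hG => discConnected_of_monodromy hm o G hG)⟩

end Literature.Topology.FourManifolds
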